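import Mathlib
import HarnessLib
import Literature.Analysis.FluidPDE.ClassicalSolution
import Literature.Analysis.FluidPDE.Vorticity
import Literature.Analysis.FluidPDE.TaoEnstrophyLocalisation
import Literature.Analysis.FluidPDE.TaoMainEstimateVelocityMass
import Summits.NavierStokesRegularity.NavierStokesRegularity.Theorems.QuarterLogPincerFlatChainTransferAnnulus

/-!
# Route `QuarterLogPincer`, crux `TypeIQuantSubcubicExp` (stmt-NavierStokesRegularity-24077), line `flat_chain` —
# transfer step 2b for S4′ `RegularBlockTransfer`: Tao's (5.18) — annular vorticity mass ⇒ velocity cube mass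

Helper toward the registered stub S4′ `stub_regularBlockTransfer` of ns-idea-7 g14's skeleton
`Cruxes/TypeIQuantSubcubicExp/Lines/flat_chain.lean`.  For the space-translated field `v = u(·, x₀ + ·)` (centre `0`)
with a regular annulus `{R < |x| < Λ₁R}` on `[t₁ − s/32, t₁]` (`‖Dʲv‖ ≤ Cg s^{-(j+1)/2}`, `j ≤ 2`), a final-time vorticity
mass `m ≤ ∫_{4R ≤ |x| ≤ Λ₁R/4} ‖ω(t₁)‖²` (the output of `annulus_vorticity_mass`, (5.17)) yields, by the tree's PROVED
(5.18) `IsClassicalNSSolutionOn.velocity_cube_mass_of_vorticity_mass` (inner radius `R″ = 2R`, ratio `Λ″ = Λ₁/4 ≥ 4`,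
vorticity-gradient bound `Ω₁ = (‖curlCLM‖+1)Cg s^{-3/2}` from `annulus_vorticity_gradient_le`, amplitude
`η := √(m/(Λ₁³R³))` so that `8η²(Λ″R″)³ = m`), a centre `x*` with `4R ≤ |x*| ≤ Λ₁R/4` and
`c₀ η³ r⁶ ≤ ∫_{B̄(x*, r)} ‖v(t₁)‖³`, `r = min(2R, η/(2Ω₁))`, for an absolute `c₀ > 0` (`annulus_cube_mass`).

HONEST FRAMING: bookkeeping around a PROVED tree theorem about HYPOTHETICAL classical solutions; part of one registered
stub (S4′, size L); nothing here bears on the truth of ⟨24077⟩, W7 or Navier–Stokes regularity (OPEN / not proved).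
pub-ns-dss typer (g39), `--supports stmt-NavierStokesRegularity-24077`.
-/

set_option linter.dupNamespace false

noncomputable section

open MeasureTheory Set Function Metric Filter Topology
open scoped ENNReal NNReal
open Literature.Analysis Literature.Analysis.FluidPDE

namespace Summit.NavierStokesRegularity.NavierStokesRegularity.Cruxes.TypeIQuantSubcubicExp.FlatChain

/-- **Tao's (5.18) across a regular annulus, block currency** (see the module docstring).
[Tao2021QuantitativeNS Thm. 5.1 proof pp. 40–41, via the tree's
`IsClassicalNSSolutionOn.velocity_cube_mass_of_vorticity_mass`] -/
theorem annulus_cube_mass :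
    ∃ c₀ : ℝ, 0 < c₀ ∧
      ∀ ⦃Cg Λ₁ s t₁ R m : ℝ⦄ ⦃v : ℝ → EuclideanSpace ℝ (Fin 3) → EuclideanSpace ℝ (Fin 3)⦄
        ⦃q : ℝ → EuclideanSpace ℝ (Fin 3) → ℝ⦄,
        1 ≤ Cg → 16 ≤ Λ₁ → 0 < s → 0 < R → 0 < m →
        IsClassicalNSSolutionOn (Icc (t₁ - s / 32) t₁) 1 0 v q →
        (∀ t ∈ Icc (t₁ - s / 32) t₁, ∀ x : EuclideanSpace ℝ (Fin 3), R < ‖x‖ → ‖x‖ < Λ₁ * R →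
          ∀ j : ℕ, j ≤ 2 → ‖iteratedFDeriv ℝ j (v t) x‖ ≤ Cg * s ^ (-(((j : ℝ) + 1) / 2))) →
        m ≤ ∫ x in closedBall (0 : EuclideanSpace ℝ (Fin 3)) (Λ₁ / 4 * (2 * R) / 2) \ ball 0 (2 * (2 * R)),
            ‖vorticity v t₁ x‖ ^ 2 →
        ∃ xs : EuclideanSpace ℝ (Fin 3), 4 * R ≤ ‖xs‖ ∧ ‖xs‖ ≤ Λ₁ * R / 4 ∧
          c₀ * Real.sqrt (m / (Λ₁ ^ 3 * R ^ 3)) ^ 3 *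
            (min (2 * R) (Real.sqrt (m / (Λ₁ ^ 3 * R ^ 3)) /
              (2 * ((‖curlCLM‖ + 1) * Cg * s ^ (-(3 / 2 : ℝ)))))) ^ 6 ≤
          ∫ x in closedBall xs (min (2 * R) (Real.sqrt (m / (Λ₁ ^ 3 * R ^ 3)) /
              (2 * ((‖curlCLM‖ + 1) * Cg * s ^ (-(3 / 2 : ℝ)))))), ‖v t₁ x‖ ^ 3 := by
  obtain ⟨c₀, hc₀, h518⟩ := IsClassicalNSSolutionOn.velocity_cube_mass_of_vorticity_mass
  refine ⟨c₀, hc₀, ?_⟩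
  intro Cg Λ₁ s t₁ R m v q hCg hΛ₁ hs hR hm hcl hreg hmass
  have hT : 0 < s / 32 := by positivity
  have hR'' : 0 < 2 * R := by linarith
  have hΛ'' : 4 ≤ Λ₁ / 4 := by linarith
  have hΛ₁pos : 0 < Λ₁ := by linarith
  have hCg0 : 0 < Cg := by linarith
  -- the vorticity-gradient bound on the closed inner annulus
  set Ω₁ : ℝ := (‖curlCLM‖ + 1) * Cg * s ^ (-(3 / 2 : ℝ)) with hΩ₁
  have hΩ₁pos : 0 < Ω₁ := by
    rw [hΩ₁]; exact mul_pos (mul_pos (by positivity) hCg0) (Real.rpow_pos_of_pos hs _)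
  have hDω : ∀ x : EuclideanSpace ℝ (Fin 3), 2 * R ≤ ‖x‖ → ‖x‖ ≤ Λ₁ / 4 * (2 * R) →
      ‖fderiv ℝ (vorticity v t₁) x‖ ≤ Ω₁ := annulus_vorticity_gradient_le hs hR hcl hreg
  -- the amplitude `η` with `8η²(Λ″R″)³ = m`
  set η : ℝ := Real.sqrt (m / (Λ₁ ^ 3 * R ^ 3)) with hη
  have hηpos : 0 < η := by rw [hη]; exact Real.sqrt_pos.2 (by positivity)
  have hηsq : 8 * η ^ 2 * (Λ₁ / 4 * (2 * R)) ^ 3 = m := by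
    rw [hη, Real.sq_sqrt (by positivity)]
    field_simp
    ring
  have hmass' : 8 * η ^ 2 * (Λ₁ / 4 * (2 * R)) ^ 3 ≤
      ∫ x in closedBall (0 : EuclideanSpace ℝ (Fin 3)) (Λ₁ / 4 * (2 * R) / 2) \ ball 0 (2 * (2 * R)),
        ‖vorticity v t₁ x‖ ^ 2 := by rw [hηsq]; exact hmass
  obtain ⟨xs, h1, h2, hcube⟩ := h518 hcl hT hR'' hΛ'' hΩ₁pos hηpos hDω hmass'
  refine ⟨xs, by linarith, ?_, hcube⟩
  have e : Λ₁ / 4 * (2 * R) / 2 = Λ₁ * R / 4 := by ring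
  rw [e] at h2
  exact h2

end Summit.NavierStokesRegularity.NavierStokesRegularity.Cruxes.TypeIQuantSubcubicExp.FlatChain

end
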